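import Literature.MathematicalPhysics.QuantumLattice.InfVolFermionStateTorusLimitEnergyEntropyBalance
import Literature.MathematicalPhysics.QuantumLattice.TorusSectorGibbsMixtureChargeRows
import Literature.MathematicalPhysics.QuantumLattice.TorusSectorGibbsMixtureSymmetry
import Literature.MathematicalPhysics.QuantumLattice.HubbardTTPrimePointGroupCovariance
import Literature.MathematicalPhysics.QuantumLattice.TorusSectorGibbsMixture
import HarnessLib

/-!
# Every `T = 0` window certificate of the `t–t'` Hubbard model is a `T > 0` certificate AT ITS OWN POINT:
# the thermal soundness of the ground-state SDP certificates, with the explicit entropy re-pricing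
# `κ · 2H_b(n/2)/β` of the energy cap

Family `hubbard` (topic `MathematicalPhysics/QuantumLattice`); seat `hubbard-downfold-unc-2` (`prover-hubbard-downfold-unc-2-g18-0`), the
`T > 0` leg of the Hubbard material-oracle programme (D-0096 (2)). Companion of the ground → thermal apex rows
(`HubbardTTPrimeApexRowGroundToThermal`, `HubbardTTPrimeThermalHalfFillingHinge`): those move a `T = 0` word to thermal states at
OTHER points of the `(t', U)` plane (price `∝ U_A/(U_P − U_A)`, infinite at the source's own point); this file reads the `T = 0`
CERTIFICATE ITSELF in the thermal state at the SAME point.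

THE OBSERVATION. A `t–t'` window certificate is an operator identity in a local algebra `𝔄_{Λ'}` (`hcert` below, the shape of
`re_expect_ge_of_window_certificate_TT'_ineq_of_nulls`): objective `Xw`, constant `c`, density multipliers `μ_σ`, the energy-CAP term
`κ·(u·1 − ΓE^{tt'}_Φ)` (`κ ≥ 0` its multiplier), a Gram/PSD part, equation-of-motion rows `[H^{tt'}_{Λ'}, ΓB_k]`, affine-`D₄` defects,
charged words, anti-Hermitian parts and residual words. The abstract-state theorem of `HubbardTTPrimeWindowCertificateAbstractState`
reads it in ANY state killing the rows, defects and charged words: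
  `c − Σ‖a_k‖ + Σ_σ μ_σ (Re ω(n_{0σ}) − ν) + κ(u − e^{tt'}(ω)) ≤ Re ω_{Λ'}(Xw)`.
A torus limit `ω` of the CANONICAL SECTOR GIBBS states at `(β; t, t', U, n)` kills all three (tree facts: stationarity
`IsTorusLimitOfMixture.expect_commutator_localHamiltonian_eq_zero_of_sectorGibbs`; exact `D₄`- and translation-invariance
`isD4Invariant_of_sectorGibbs` + `IsTranslationInvariant.expect_fermionEmbed_d4Emb`; `U(1) × U(1)` charge nulls
`expect_ladderWord_eq_zero_of_sectorGibbs`), reads `Re ω(n_{0σ}) = n/2`, and its energy obeys the universal energy–entropy cap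
`e^{tt'}(ω) ≤ e(t,t',U,n) + 2H_b(n/2)/β ≤ u + 2H_b(n/2)/β` (`TorusSectorGibbsMixture`). Hence (§1)

  `c − κ·2H_b(n/2)/β − Σ‖a_k‖ + (Σ_σ μ_σ)(n/2 − ν) ≤ Re ω_{Λ'}(Xw)`   for EVERY `β > 0`

— literally the conclusion of the ground-state soundness theorem `IsTorusLimitOf.re_sum_expect_d4_ge_of_window_certificate_TT'_ineq`
(whose `D₄`-orbit mean is here the plain value, thermal torus limits being exactly `D₄`-invariant, §2) MINUS the entropy re-pricing
`κ·2H_b(n/2)/β` of the cap row. Reading: a `T = 0` claim node of record with cap multiplier `κ` (printed in every certificate) is a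
thermal node at its own point `(t', U, n)` at every temperature with value `r − κ·2H_b(n/2)/β` (`2H_b(1/2) = log 4`; La214-E stiffness
nodes carry `κ ≈ 0.14–0.45`, so the thermal price is `≈ 0.2–0.6 × T/t` in stiffness units — at `T = t/20` a few `10⁻²`). §1 also keeps the
energy slot symbolic (`…_of_energyCap`: any certified thermal energy cap `e^{tt'}(ω) ≤ u'` gives `c + κ(u − u') − …`), the input shape of
thermal certificates / hubbard-tc's energy windows.

HONEST SCOPE: soundness statements about certificate IDENTITIES (`hcert` as a hypothesis); for SDP certificates of record the identity lives
in the certificate bytes and the tree carries `@[conjecture]` claim nodes of the GROUND-STATE row shape — a thermal reading of such a node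
needs a thermal node (same bytes, this theorem as warrant), it is NOT implied by the ground-state `Prop`. No certificate, no number, no
phase sentence. The price `κ·2H_b(n/2)/β` is the crude `S ≤ log dim` bound; no low-temperature improvement is claimed.

## Mathlib / tree search
REUSED (by name above) `re_expect_ge_of_window_certificate_TT'_ineq_of_nulls` (`HubbardTTPrimeWindowCertificateAbstractState`), the sector-Gibbs
null rows (`InfVolFermionStateTorusLimitEnergyEntropyBalance`, `TorusSectorGibbsMixtureChargeRows`, `TorusSectorGibbsMixtureSymmetry`),
`IsTranslationInvariant.expect_fermionEmbed_d4Emb` (`HubbardTTPrimePointGroupCovariance`), the entropy cap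
`IsTorusLimitOfMixture.meanEnergy_hubbardTTPrime_le_energyDensityTT'_add_binEntropy_div` (`TorusSectorGibbsMixture`).
`lean search 'window_certificate.*[Tt]hermal|sectorGibbs.*window_certificate'`: the tree's thermal certificate readers
(`…re_expect_ge_of_thermal_certificate_symm_TT'_of_sectorGibbs`) read THERMAL (energy–entropy-balance) certificates; no reader of a `T = 0`
window certificate in a thermal state existed.

## References
* J. Wang et al., PRX 14 (2024) 031006, §III (every state satisfying the relaxation's constraints obeys the certified bound).
  [cite: WangEtAl2024, §III]
* H. Fawzi, O. Fawzi, S. O. Scalet, *Certified algorithms for equilibrium states of local quantum Hamiltonians* (2024), Thm. 3.1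
  (stationarity rows of equilibrium states). [cite: FawziFawziScalet2024, Thm. 3.1]
* D. Ruelle, *Statistical Mechanics* (1969), §2.5 (`E ≤ E₀ + T·S_max`). [cite: Ruelle1969, §2.5]
* X. Han, *Quantum many-body bootstrap* (2020), §3 (symmetry reductions). [cite: Han2020Bootstrap, §3]
-/

noncomputable section

namespace Literature.MathematicalPhysics.QuantumLattice

open Matrix Finset HubbardWave0 Literature.Probability.LatticeModels ThermodynamicLimit
open Literature.MathematicalPhysics.QuantumManyBody.StateRelaxation
open _root_.Filter
open scoped _root_.Topology ComplexOrder BigOperators Matrix.Norms.L2Operator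

namespace InfVolFermionState

variable {t t' U n β : ℝ}

/-! ### §1 The `T = 0` window certificate read in a thermal torus limit -/

/-- **THE `T = 0` WINDOW CERTIFICATE IN A THERMAL TORUS LIMIT, energy slot symbolic.** Let the certificate identity `hcert` hold in
`𝔄_{Λ'}` (eom generators `B_k ∈ 𝔄_Λ`, `thicken Λ 1 ⊆ Λ'`; defects with ANY point-group labels; charged words with nonzero particle or spin
charge), and let `ω` be a torus limit of the canonical `(rectN n L, S^z = 0)`-sector Gibbs states of `hubbardTorusTT' L t t' U` at inverse
temperature `β` (`0 ≤ n ≤ 2`; ANY `β`, any tori). Then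
`c − Σ‖a_k‖ + (Σ_σ μ_σ)(n/2 − ν) + κ(u − e^{tt'}(ω)) ≤ Re ω_{Λ'}(Xw)` — the rows hold by stationarity, the defects by exact `D₄` × translation
invariance, the charged words by the `U(1) × U(1)` symmetry of the sectors, and `Re ω(n_{0σ}) = n/2`. [cite: WangEtAl2024, §III] [cite: FawziFawziScalet2024, Thm. 3.1] -/
theorem IsTorusLimitOfMixture.re_expect_ge_of_window_certificate_TT'_ineq_of_sectorGibbs_energySlot
    (hn0 : 0 ≤ n) (hn2 : n ≤ 2)
    {Λ Λ' : Finset (Site 2)} (hΛ : Λ ⊆ Λ') (h8 : thicken Λ 1 ⊆ Λ')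
    (h0 : thicken ({0} : Finset (Site 2)) 1 ⊆ Λ') (hz : (0 : Site 2) ∈ Λ')
    (Xw : FermionOp Λ') (κ u : ℝ) (μ : Fin 2 → ℝ) (ν : ℝ)
    {m : Type*} [Fintype m] [DecidableEq m] {Λm : Matrix m m ℂ} (hΛm : Λm.PosSemidef)
    (O : m → FermionOp Λ')
    {κ' : Type*} (s : Finset κ') (B : κ' → FermionOp Λ)
    {ι : Type*} (tt : Finset ι) (γ : ι → DihedralGroup 4) (wv : ι → Site 2)
    (hsh : ∀ l, d4ShiftSet (γ l) (wv l) Λ ⊆ Λ') (Y : ι → FermionOp Λ)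
    {ρ : Type*} (uu : Finset ρ) (b : ρ → ℂ) (cw : ρ → List (Orb (PolySite Λ') × Bool))
    (hcw : ∀ j ∈ uu, ladderCharge (cw j) ≠ 0 ∨ ladderSpinCharge (cw j) ≠ 0)
    {δ : Type*} (ah : Finset δ) (dc : δ → ℝ) (V : δ → FermionOp Λ')
    {κ'' : Type*} (w : Finset κ'') (a : κ'' → ℂ) (word : κ'' → List (Orb (PolySite Λ') × Bool)) {c : ℝ}
    (hcert : Xw - (c : ℂ) • (1 : FermionOp Λ') -
        ∑ σ : Fin 2, ((μ σ : ℝ) : ℂ) • (nAt 0 hz σ - ((ν : ℝ) : ℂ) • (1 : FermionOp Λ')) -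
        ((κ : ℝ) : ℂ) • (((u : ℝ) : ℂ) • (1 : FermionOp Λ') -
          fermionEmbed (PolySite.incl h0) ((hubbardTTPrimeFermionInteraction t t' U).meanEnergyObs 1)) =
      gramForm Λm O +
        (∑ k ∈ s, ((hubbardTTPrimeFermionInteraction t t' U).localHamiltonian Λ' * fermionEmbed (PolySite.incl hΛ) (B k) -
            fermionEmbed (PolySite.incl hΛ) (B k) * (hubbardTTPrimeFermionInteraction t t' U).localHamiltonian Λ') +
          ∑ l ∈ tt, (fermionEmbed (PolySite.incl (hsh l)) (fermionEmbed (PolySite.d4Emb (γ l) (wv l) Λ) (Y l)) -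
            fermionEmbed (PolySite.incl hΛ) (Y l)) +
          ∑ j ∈ uu, b j • ladderWord (cw j)) +
        (∑ m' ∈ ah, ((dc m' : ℝ) : ℂ) • ((V m')ᴴ - V m') + ∑ k ∈ w, a k • ladderWord (word k)))
    {ω : InfVolFermionState 2} {Ls : ℕ → ℕ}
    (hω : ω.IsTorusLimitOfMixture (sectorGibbsCount n) (fun L => sectorGibbsWeightTT' β t t' U n L)
      (fun L => sectorGibbsVectorTT' t t' U n L) Ls)
    (hLs : Tendsto Ls atTop atTop) :
    c - ∑ k ∈ w, ‖a k‖ + (∑ σ : Fin 2, μ σ) * (n / 2 - ν) +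
        κ * (u - ω.meanEnergy (hubbardTTPrimeFermionInteraction t t' U) 1) ≤
      (ω.expect Λ' Xw).re := by
  have hTI := hω.isTranslationInvariant
  have hD := hω.isD4Invariant_of_sectorGibbs t t' U n β hLs
  -- the three null families
  have heom : ∀ k ∈ s, ω.expect Λ'
      ((hubbardTTPrimeFermionInteraction t t' U).localHamiltonian Λ' * fermionEmbed (PolySite.incl hΛ) (B k) -
        fermionEmbed (PolySite.incl hΛ) (B k) * (hubbardTTPrimeFermionInteraction t t' U).localHamiltonian Λ') = 0 :=
    fun k _ => hω.expect_commutator_localHamiltonian_eq_zero_of_sectorGibbs t t' U β hLs hΛ h8 (B k)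
  have hsym : ∀ l ∈ tt, ω.expect Λ'
      (fermionEmbed (PolySite.incl (hsh l)) (fermionEmbed (PolySite.d4Emb (γ l) (wv l) Λ) (Y l)) -
        fermionEmbed (PolySite.incl hΛ) (Y l)) = 0 := by
    intro l _
    rw [map_sub, hTI.expect_fermionEmbed_d4Emb (γ l) (wv l) (hsh l) (Y l), hD (γ l), ω.compatible hΛ, sub_self]
  have hch : ∀ j ∈ uu, ω.expect Λ' (ladderWord (cw j)) = 0 :=
    fun j hj => hω.expect_ladderWord_eq_zero_of_sectorGibbs t t' U n β hLs (cw j) (hcw j hj)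
  have hmain := ω.re_expect_ge_of_window_certificate_TT'_ineq_of_nulls t t' U hΛ h0 hz Xw κ u μ ν hΛm O s B tt γ wv hsh
    Y uu b cw ah dc V w a word hcert heom hsym hch
  -- the density slots read `n/2`
  have hdens : ∀ σ : Fin 2, (ω.expect Λ' (nAt 0 hz σ)).re = n / 2 := by
    intro σ
    have h1 : ω.expect Λ' (nAt 0 hz σ) = ω.expect {0} (nAt 0 (Finset.mem_singleton_self 0) σ) := by
      rw [← ω.compatible (Finset.singleton_subset_iff.2 hz), fermionEmbed_numberOp, PolySite.incl_pt]
    rw [h1, hω.expect_nAt_eq_of_sectorGibbs t t' U hn0 hn2 β hLs σ, Complex.ofReal_re]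
  have hslot : ∑ σ : Fin 2, μ σ * ((ω.expect Λ' (nAt 0 hz σ)).re - ν) = (∑ σ : Fin 2, μ σ) * (n / 2 - ν) := by
    rw [Finset.sum_mul]
    exact Finset.sum_congr rfl fun σ _ => by rw [hdens σ]
  linarith [hmain, hslot]

/-- **THE `T = 0` WINDOW CERTIFICATE IS A THERMAL CERTIFICATE AT ITS OWN POINT, entropy re-pricing.** Same data; `U ≥ 0`, `0 ≤ n < 2`,
`β > 0`, `κ ≥ 0`, and the cap literal certified at `T = 0`: `e(t,t',U,n) ≤ u`. Then for every torus limit `ω` of the canonical sector Gibbs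
states at `(β; t, t', U, n)`:
`c − κ·2H_b(n/2)/β − Σ‖a_k‖ + (Σ_σ μ_σ)(n/2 − ν) ≤ Re ω_{Λ'}(Xw)`
(the energy slot of `…_energySlot` against the universal cap `e^{tt'}(ω) ≤ e + 2H_b(n/2)/β`). The ground-state conclusion minus
`κ·2H_b(n/2)/β`. [cite: WangEtAl2024, §III] [cite: Ruelle1969, §2.5] -/
theorem IsTorusLimitOfMixture.re_expect_ge_of_window_certificate_TT'_ineq_of_sectorGibbs_thermal
    (hU : 0 ≤ U) (hn0 : 0 ≤ n) (hn2 : n < 2) (hβ : 0 < β) {κ u : ℝ} (hκ : 0 ≤ κ)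
    (hu : energyDensityTT' t t' U n ≤ u)
    {Λ Λ' : Finset (Site 2)} (hΛ : Λ ⊆ Λ') (h8 : thicken Λ 1 ⊆ Λ')
    (h0 : thicken ({0} : Finset (Site 2)) 1 ⊆ Λ') (hz : (0 : Site 2) ∈ Λ')
    (Xw : FermionOp Λ') (μ : Fin 2 → ℝ) (ν : ℝ)
    {m : Type*} [Fintype m] [DecidableEq m] {Λm : Matrix m m ℂ} (hΛm : Λm.PosSemidef)
    (O : m → FermionOp Λ')
    {κ' : Type*} (s : Finset κ') (B : κ' → FermionOp Λ)
    {ι : Type*} (tt : Finset ι) (γ : ι → DihedralGroup 4) (wv : ι → Site 2)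
    (hsh : ∀ l, d4ShiftSet (γ l) (wv l) Λ ⊆ Λ') (Y : ι → FermionOp Λ)
    {ρ : Type*} (uu : Finset ρ) (b : ρ → ℂ) (cw : ρ → List (Orb (PolySite Λ') × Bool))
    (hcw : ∀ j ∈ uu, ladderCharge (cw j) ≠ 0 ∨ ladderSpinCharge (cw j) ≠ 0)
    {δ : Type*} (ah : Finset δ) (dc : δ → ℝ) (V : δ → FermionOp Λ')
    {κ'' : Type*} (w : Finset κ'') (a : κ'' → ℂ) (word : κ'' → List (Orb (PolySite Λ') × Bool)) {c : ℝ}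
    (hcert : Xw - (c : ℂ) • (1 : FermionOp Λ') -
        ∑ σ : Fin 2, ((μ σ : ℝ) : ℂ) • (nAt 0 hz σ - ((ν : ℝ) : ℂ) • (1 : FermionOp Λ')) -
        ((κ : ℝ) : ℂ) • (((u : ℝ) : ℂ) • (1 : FermionOp Λ') -
          fermionEmbed (PolySite.incl h0) ((hubbardTTPrimeFermionInteraction t t' U).meanEnergyObs 1)) =
      gramForm Λm O +
        (∑ k ∈ s, ((hubbardTTPrimeFermionInteraction t t' U).localHamiltonian Λ' * fermionEmbed (PolySite.incl hΛ) (B k) -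
            fermionEmbed (PolySite.incl hΛ) (B k) * (hubbardTTPrimeFermionInteraction t t' U).localHamiltonian Λ') +
          ∑ l ∈ tt, (fermionEmbed (PolySite.incl (hsh l)) (fermionEmbed (PolySite.d4Emb (γ l) (wv l) Λ) (Y l)) -
            fermionEmbed (PolySite.incl hΛ) (Y l)) +
          ∑ j ∈ uu, b j • ladderWord (cw j)) +
        (∑ m' ∈ ah, ((dc m' : ℝ) : ℂ) • ((V m')ᴴ - V m') + ∑ k ∈ w, a k • ladderWord (word k)))
    {ω : InfVolFermionState 2} {Ls : ℕ → ℕ}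
    (hω : ω.IsTorusLimitOfMixture (sectorGibbsCount n) (fun L => sectorGibbsWeightTT' β t t' U n L)
      (fun L => sectorGibbsVectorTT' t t' U n L) Ls)
    (hLs : Tendsto Ls atTop atTop) :
    c - κ * (2 * Real.binEntropy (n / 2) / β) - ∑ k ∈ w, ‖a k‖ + (∑ σ : Fin 2, μ σ) * (n / 2 - ν) ≤
      (ω.expect Λ' Xw).re := by
  have hslot := IsTorusLimitOfMixture.re_expect_ge_of_window_certificate_TT'_ineq_of_sectorGibbs_energySlot hn0 hn2.le
    hΛ h8 h0 hz Xw κ u μ ν hΛm O s B tt γ wv hsh Y uu b cw hcw ah dc V w a word hcert hω hLs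
  have hcap := hω.meanEnergy_hubbardTTPrime_le_energyDensityTT'_add_binEntropy_div t t' hU hn0 hn2 hβ hLs
  have hκe : -(κ * (2 * Real.binEntropy (n / 2) / β)) ≤
      κ * (u - ω.meanEnergy (hubbardTTPrimeFermionInteraction t t' U) 1) := by
    have : -(2 * Real.binEntropy (n / 2) / β) ≤ u - ω.meanEnergy (hubbardTTPrimeFermionInteraction t t' U) 1 := by
      linarith
    nlinarith
  linarith

/-! ### §2 The `D₄`-orbit form (parity with the ground-state node shape) -/

/-- **Orbit-mean form.** A thermal torus limit is exactly `D₄`-invariant, so for every nonempty label set `S ⊆ D₄` the orbit mean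
`|S|⁻¹ Σ_{g∈S} Re ω_{gΛ'}(Γ(d4Emb g 0) Xw)` equals `Re ω_{Λ'}(Xw)`; hence the thermal conclusion also holds in the orbit-mean shape of the
ground-state row of record (`SquareTTPrimeCorrOrbitLowerRow`-style). [cite: Han2020Bootstrap, §3] [cite: WangEtAl2024, §III] -/
theorem IsTorusLimitOfMixture.re_sum_expect_d4_ge_of_window_certificate_TT'_ineq_of_sectorGibbs_thermal
    (hU : 0 ≤ U) (hn0 : 0 ≤ n) (hn2 : n < 2) (hβ : 0 < β) {κ u : ℝ} (hκ : 0 ≤ κ)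
    (hu : energyDensityTT' t t' U n ≤ u)
    {Λ Λ' : Finset (Site 2)} (hΛ : Λ ⊆ Λ') (h8 : thicken Λ 1 ⊆ Λ')
    (h0 : thicken ({0} : Finset (Site 2)) 1 ⊆ Λ') (hz : (0 : Site 2) ∈ Λ')
    {S : Finset (DihedralGroup 4)} (hS : S.Nonempty)
    (Xw : FermionOp Λ') (μ : Fin 2 → ℝ) (ν : ℝ)
    {m : Type*} [Fintype m] [DecidableEq m] {Λm : Matrix m m ℂ} (hΛm : Λm.PosSemidef)
    (O : m → FermionOp Λ')
    {κ' : Type*} (s : Finset κ') (B : κ' → FermionOp Λ)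
    {ι : Type*} (tt : Finset ι) (γ : ι → DihedralGroup 4) (wv : ι → Site 2)
    (hsh : ∀ l, d4ShiftSet (γ l) (wv l) Λ ⊆ Λ') (Y : ι → FermionOp Λ)
    {ρ : Type*} (uu : Finset ρ) (b : ρ → ℂ) (cw : ρ → List (Orb (PolySite Λ') × Bool))
    (hcw : ∀ j ∈ uu, ladderCharge (cw j) ≠ 0 ∨ ladderSpinCharge (cw j) ≠ 0)
    {δ : Type*} (ah : Finset δ) (dc : δ → ℝ) (V : δ → FermionOp Λ')
    {κ'' : Type*} (w : Finset κ'') (a : κ'' → ℂ) (word : κ'' → List (Orb (PolySite Λ') × Bool)) {c : ℝ}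
    (hcert : Xw - (c : ℂ) • (1 : FermionOp Λ') -
        ∑ σ : Fin 2, ((μ σ : ℝ) : ℂ) • (nAt 0 hz σ - ((ν : ℝ) : ℂ) • (1 : FermionOp Λ')) -
        ((κ : ℝ) : ℂ) • (((u : ℝ) : ℂ) • (1 : FermionOp Λ') -
          fermionEmbed (PolySite.incl h0) ((hubbardTTPrimeFermionInteraction t t' U).meanEnergyObs 1)) =
      gramForm Λm O +
        (∑ k ∈ s, ((hubbardTTPrimeFermionInteraction t t' U).localHamiltonian Λ' * fermionEmbed (PolySite.incl hΛ) (B k) -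
            fermionEmbed (PolySite.incl hΛ) (B k) * (hubbardTTPrimeFermionInteraction t t' U).localHamiltonian Λ') +
          ∑ l ∈ tt, (fermionEmbed (PolySite.incl (hsh l)) (fermionEmbed (PolySite.d4Emb (γ l) (wv l) Λ) (Y l)) -
            fermionEmbed (PolySite.incl hΛ) (Y l)) +
          ∑ j ∈ uu, b j • ladderWord (cw j)) +
        (∑ m' ∈ ah, ((dc m' : ℝ) : ℂ) • ((V m')ᴴ - V m') + ∑ k ∈ w, a k • ladderWord (word k)))
    {ω : InfVolFermionState 2} {Ls : ℕ → ℕ}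
    (hω : ω.IsTorusLimitOfMixture (sectorGibbsCount n) (fun L => sectorGibbsWeightTT' β t t' U n L)
      (fun L => sectorGibbsVectorTT' t t' U n L) Ls)
    (hLs : Tendsto Ls atTop atTop) :
    c - κ * (2 * Real.binEntropy (n / 2) / β) - ∑ k ∈ w, ‖a k‖ + (∑ σ : Fin 2, μ σ) * (n / 2 - ν) ≤
      (S.card : ℝ)⁻¹ * ∑ g ∈ S, (ω.expect (d4ShiftSet g 0 Λ') (fermionEmbed (PolySite.d4Emb g 0 Λ') Xw)).re := by
  have hD := hω.isD4Invariant_of_sectorGibbs t t' U n β hLs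
  have hconst : ∑ g ∈ S, (ω.expect (d4ShiftSet g 0 Λ') (fermionEmbed (PolySite.d4Emb g 0 Λ') Xw)).re =
      (S.card : ℝ) * (ω.expect Λ' Xw).re := by
    rw [Finset.sum_congr rfl fun g _ => by rw [hD.expect_fermionEmbed_d4Emb g Λ' Xw], Finset.sum_const, nsmul_eq_mul]
  have hcard : (0 : ℝ) < S.card := Nat.cast_pos.2 (Finset.card_pos.2 hS)
  rw [hconst, ← mul_assoc, inv_mul_cancel₀ hcard.ne', one_mul]
  exact IsTorusLimitOfMixture.re_expect_ge_of_window_certificate_TT'_ineq_of_sectorGibbs_thermal hU hn0 hn2 hβ hκ hu hΛ h8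
    h0 hz Xw μ ν hΛm O s B tt γ wv hsh Y uu b cw hcw ah dc V w a word hcert hω hLs

end InfVolFermionState

end Literature.MathematicalPhysics.QuantumLattice

end
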